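import Summits.CriticalPhenomena.SAWScalingLimit.Theorems.SAWDefectDecoherenceBoundaryClosureRDevelopingMapsCompactAA
import Summits.CriticalPhenomena.SAWScalingLimit.Theorems.SAWDefectDecoherenceBoundaryClosureRDevelopingMapsCompactLink
import Summits.CriticalPhenomena.SAWScalingLimit.Theorems.SAWDefectDecoherenceBoundaryClosureRDevelopingMapsCompactFlat
import Summits.CriticalPhenomena.SAWScalingLimit.Theorems.SAWDevelopingMapPotentialExists
import HarnessLib

/-!
# Developing maps: compactness (crux `BoundaryClosureR`, stmt-CriticalPhenomena-14004, line
`pick-half-plane`, stub `stub_developingMapsCompact`)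

`developingMapsCompact` (the registered statement `LocalSupBound → DevelopingMapsCompact` of the
skeleton, line-local definitions unfolded): for every admissible family, pinned flat root
`x ≠ pt 1` and mesh sequence `ns → 0+`, some subsequence of the normalised developing maps
`h_δ(s) = δ (H s − H s_b)/F_δ(b δ)` (`H` any potential of the root-`e δ` observable, `s_b` either
normaliser site) converges locally uniformly on `U = (carrier ∪ flat pieces) ∖ {x}` to a function
`h` continuous on `U`.

Proof.  `local_data`: at every point of `U` the three local inputs of the lattice Arzelà–Ascoli
theorem — the equi-Lipschitz link of the maps at the lattice sites, their two-sided bound, the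
density of lattice sites (interior points: `interior_link`, `station_bound`, `interior_density`;
flat points: `flat_link`, `flat_station`, `flat_density` in the gate frame or in the root frame).
`developingMapsCompact_core`: choose one potential `Href δ` and one normaliser site per scale and
apply `latticeArzelaAscoli` to `V δ s = δ (Href δ s − Href δ s_ref)/F(b δ)` on the lattice sites
of `Λ δ`; pass to ALL potentials (unique up to constants on the connected `Λ δ`,
`sub_eq_sub_of_preconnected`) and both normaliser sites (`normaliser_sites_close`).
Reference: Duminil-Copin–Smirnov 2012, §4 (precompactness of the maps `H_δ`).
-/

noncomputable section

open scoped Topology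
open Filter Set
open Literature.Probability.LatticeModels Literature.Probability.RandomPlanarGeometry
open Literature.Probability.RandomPlanarGeometry.SAW
open Summit.CriticalPhenomena.SAWScalingLimit.Theorems.PickHalfPlane.RootWedge

namespace Summit.CriticalPhenomena.SAWScalingLimit.Theorems.PickHalfPlane.DevelopingMaps

section Frame

/-! ### The frame: an admissible family, a pinned flat root off the normaliser, the local sup law -/

variable {D : DobrushinDomain} {ρ : ℝ} {Λ : ℝ → Finset HexVertex} {m : ℝ → ℤ} {b : ℝ → Sym2 HexVertex}
  (hAF : 0 < ρ ∧
    D.carrier ∩ Metric.ball (D.pt 1) ρ = {z : ℂ | (D.pt 1).im < z.im} ∩ Metric.ball (D.pt 1) ρ ∧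
    (∀ᶠ δ : ℝ in 𝓝[>] 0, hexDomainSimplyConnected (Λ δ) ∧ b δ ∈ hexDomainBoundary (Λ δ) ∧
      (hexGraph.induce ((Λ δ : Finset HexVertex) : Set HexVertex)).Preconnected ∧
      (∀ v ∈ Λ δ, (δ : ℂ) * hexCenter v ∈ D.carrier) ∧
      (∀ v : HexVertex, (δ : ℂ) * hexCenter v ∈ Metric.ball (D.pt 1) ρ →
        (v ∈ Λ δ ↔ m δ ≤ v.1 1))) ∧
    (∀ K : Set ℂ, IsCompact K → K ⊆ D.carrier →
      ∀ᶠ δ : ℝ in 𝓝[>] 0, ∀ v : HexVertex, (δ : ℂ) * hexCenter v ∈ K → v ∈ Λ δ) ∧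
    Tendsto (fun δ : ℝ => (δ : ℂ) * hexMidpoint (b δ)) (𝓝[>] 0) (𝓝 (D.pt 1)))
  {x : ℂ} {e : ℝ → Sym2 HexVertex} {r : ℝ} {mr : ℝ → ℤ}
  (hPR : 0 < r ∧ D.carrier ∩ Metric.ball x r = {z : ℂ | x.im < z.im} ∩ Metric.ball x r ∧
    (∀ᶠ δ : ℝ in 𝓝[>] 0, e δ ∈ hexDomainBoundary (Λ δ) ∧
      Nonempty (HexMidEdgeSAW (Λ δ) (e δ) (b δ)) ∧
      (∀ v : HexVertex, (δ : ℂ) * hexCenter v ∈ Metric.ball x r → (v ∈ Λ δ ↔ mr δ ≤ v.1 1))) ∧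
    Tendsto (fun δ : ℝ => (δ : ℂ) * hexMidpoint (e δ)) (𝓝[>] 0) (𝓝 x))
  (hx : x ≠ D.pt 1)
  (hSup : ∀ K : Set ℂ, IsCompact K →
    K ⊆ D.carrier ∪ (({z : ℂ | z.im = (D.pt 1).im} ∩ Metric.ball (D.pt 1) ρ) ∪
      ({z : ℂ | z.im = x.im} ∩ Metric.ball x r)) → x ∉ K →
    ∃ C : ℝ, ∀ᶠ δ : ℝ in 𝓝[>] 0, ∀ z ∈ hexDomainMidEdges (Λ δ), (δ : ℂ) * hexMidpoint z ∈ K →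
      ‖hexParafermionicObservable (Λ δ) (e δ) hexCriticalFugacity (5 / 8) z‖ ≤
        C * ‖hexParafermionicObservable (Λ δ) (e δ) hexCriticalFugacity (5 / 8) (b δ)‖)

include hAF hPR hx hSup

omit hPR hx in
/-- The local sup law on the compacts of the closed gate half-ball off `x`. [folklore] -/
theorem sup_gate : ∀ K : Set ℂ, IsCompact K → K ⊆ {z : ℂ | (D.pt 1).im ≤ z.im} ∩ Metric.ball (D.pt 1) ρ →
    x ∉ K → ∃ C : ℝ, ∀ᶠ δ : ℝ in 𝓝[>] 0, ∀ w ∈ hexDomainMidEdges (Λ δ), (δ : ℂ) * hexMidpoint w ∈ K →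
      ‖hexParafermionicObservable (Λ δ) (e δ) hexCriticalFugacity (5 / 8) w‖ ≤
        C * ‖hexParafermionicObservable (Λ δ) (e δ) hexCriticalFugacity (5 / 8) (b δ)‖ := by
  refine fun K hK hKsub hxK => hSup K hK (fun w hw => ?_) hxK
  obtain ⟨hwim, hwb⟩ := hKsub hw
  rcases (show (D.pt 1).im ≤ w.im from hwim).lt_or_eq with hlt | heq
  · exact Or.inl ((show w ∈ D.carrier ∩ Metric.ball (D.pt 1) ρ by rw [hAF.2.1]; exact ⟨hlt, hwb⟩).1)
  · exact Or.inr (Or.inl ⟨heq.symm, hwb⟩)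

omit hAF hx in
/-- The local sup law on the compacts of the closed root half-ball off `x`. [folklore] -/
theorem sup_root : ∀ K : Set ℂ, IsCompact K → K ⊆ {z : ℂ | x.im ≤ z.im} ∩ Metric.ball x r →
    x ∉ K → ∃ C : ℝ, ∀ᶠ δ : ℝ in 𝓝[>] 0, ∀ w ∈ hexDomainMidEdges (Λ δ), (δ : ℂ) * hexMidpoint w ∈ K →
      ‖hexParafermionicObservable (Λ δ) (e δ) hexCriticalFugacity (5 / 8) w‖ ≤
        C * ‖hexParafermionicObservable (Λ δ) (e δ) hexCriticalFugacity (5 / 8) (b δ)‖ := by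
  refine fun K hK hKsub hxK => hSup K hK (fun w hw => ?_) hxK
  obtain ⟨hwim, hwb⟩ := hKsub hw
  rcases (show x.im ≤ w.im from hwim).lt_or_eq with hlt | heq
  · exact Or.inl ((show w ∈ D.carrier ∩ Metric.ball x r by rw [hPR.2.1]; exact ⟨hlt, hwb⟩).1)
  · exact Or.inr (Or.inr ⟨heq.symm, hwb⟩)

/-- **The local data at a point of the punctured closed region.**  At every point `z` of
`(carrier ∪ flat pieces) ∖ {x}` there are `η > 0`, `B, C ≥ 0` with, eventually as `δ → 0+`:
(EQ) `‖δ(H s' − H s)/F(b δ)‖ ≤ C(‖δ s' − δ s‖ + δ)` for every potential `H` and all lattice sites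
`s, s'` within `η` of `z`; (BD) `δ‖H s − H s_b‖ ≤ B‖F(b δ)‖` for every potential, normaliser site
`s_b` and lattice site `s` within `η` of `z`; (DS) for every `θ > 0`, eventually a lattice site
within `θ` of `z`. [cite: DuminilCopinSmirnov2012, §4 (the map H with dH = F dz)] -/
theorem local_data
    {z : ℂ} (hz : z ∈ (D.carrier ∪ (({z : ℂ | z.im = (D.pt 1).im} ∩ Metric.ball (D.pt 1) ρ) ∪
        ({z : ℂ | z.im = x.im} ∩ Metric.ball x r))) \ {x}) :
    ∃ η B C : ℝ, 0 < η ∧ 0 ≤ B ∧ 0 ≤ C ∧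
      (∀ᶠ δ : ℝ in 𝓝[>] 0, ∀ H : Site 2 → ℂ, IsPotential (Λ δ) (e δ) H →
        ∀ s s' : Site 2, IsLatticeSite (Λ δ) s → IsLatticeSite (Λ δ) s' →
        ‖(δ : ℂ) * triEmbed s - z‖ ≤ η → ‖(δ : ℂ) * triEmbed s' - z‖ ≤ η →
          ‖(δ : ℂ) * (H s' - H s) / hexParafermionicObservable (Λ δ) (e δ) hexCriticalFugacity (5 / 8) (b δ)‖ ≤
            C * (‖(δ : ℂ) * triEmbed s' - (δ : ℂ) * triEmbed s‖ + δ)) ∧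
      (∀ᶠ δ : ℝ in 𝓝[>] 0, ∀ H : Site 2 → ℂ, IsPotential (Λ δ) (e δ) H →
        ∀ ub wb : HexVertex, b δ = s(ub, wb) →
        ∀ sb : Site 2, sb ∈ hexFaceVertices ub → sb ∈ hexFaceVertices wb →
        ∀ s : Site 2, IsLatticeSite (Λ δ) s → ‖(δ : ℂ) * triEmbed s - z‖ ≤ η →
          δ * ‖H s - H sb‖ ≤ B * ‖hexParafermionicObservable (Λ δ) (e δ) hexCriticalFugacity (5 / 8) (b δ)‖) ∧
      (∀ θ : ℝ, 0 < θ → ∀ᶠ δ : ℝ in 𝓝[>] 0, ∃ s : Site 2, IsLatticeSite (Λ δ) s ∧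
        ‖(δ : ℂ) * triEmbed s - z‖ < θ) := by
  have hAF' := hAF
  have hPR' := hPR
  obtain ⟨hρ, hcar, hev, hexh, hblim⟩ := hAF'
  obtain ⟨hr, hcarx, hevx, helim⟩ := hPR'
  set p : ℂ := D.pt 1 with hp
  have hFb : ∀ᶠ δ : ℝ in 𝓝[>] 0,
      hexParafermionicObservable (Λ δ) (e δ) hexCriticalFugacity (5 / 8) (b δ) ≠ 0 :=
    (LocalL1.eventually_normaliser_ne_zero_of_bundles hev hevx).mono fun δ h => h.1
  have hxcar : x ∉ D.carrier := fun h => by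
    have h' : x ∈ D.carrier ∩ Metric.ball x r := ⟨h, Metric.mem_ball_self hr⟩
    rw [hcarx] at h'
    exact lt_irrefl _ (show x.im < x.im from h'.1)
  -- the sup law on the compacts of the carrier, of the gate frame and of the root frame
  have hSupΩ : ∀ K : Set ℂ, IsCompact K → K ⊆ D.carrier →
      ∃ C : ℝ, ∀ᶠ δ : ℝ in 𝓝[>] 0, ∀ w ∈ hexDomainMidEdges (Λ δ), (δ : ℂ) * hexMidpoint w ∈ K →
        ‖hexParafermionicObservable (Λ δ) (e δ) hexCriticalFugacity (5 / 8) w‖ ≤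
          C * ‖hexParafermionicObservable (Λ δ) (e δ) hexCriticalFugacity (5 / 8) (b δ)‖ :=
    fun K hK hKs => hSup K hK (fun w hw => Or.inl (hKs hw)) fun h => hxcar (hKs h)
  have hSupGate := sup_gate hAF hSup
  have hSupRoot := sup_root hPR hSup
  have hst : ∀ z' ∈ D.carrier, ∃ B η : ℝ, 0 ≤ B ∧ 0 < η ∧ ∀ᶠ δ : ℝ in 𝓝[>] 0, ∀ H : Site 2 → ℂ,
      IsPotential (Λ δ) (e δ) H → ∀ ub wb : HexVertex, b δ = s(ub, wb) →
      ∀ sb : Site 2, sb ∈ hexFaceVertices ub → sb ∈ hexFaceVertices wb →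
      ∀ s : Site 2, ‖(δ : ℂ) * triEmbed s - z'‖ ≤ η →
        δ * ‖H s - H sb‖ ≤ B * ‖hexParafermionicObservable (Λ δ) (e δ) hexCriticalFugacity (5 / 8) (b δ)‖ :=
    fun z' hz' => station_bound hAF hPR hx hSup hz'
  obtain ⟨hzU, hzx⟩ := hz
  have hzx' : z ≠ x := hzx
  rcases hzU with hzc | ⟨hzim, hzb⟩ | ⟨hzim, hzb⟩
  · ---------------------------------------------------------------- a point of the carrier
    obtain ⟨η₁, C, hη₁, hC, hlink⟩ := interior_link (e := e) (b := b) D.isOpen hexh hSupΩ hzc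
    obtain ⟨B, η₂, hB, hη₂, hbd⟩ := station_bound hAF hPR hx hSup hzc
    refine ⟨min η₁ η₂, B, C, lt_min hη₁ hη₂, hB, hC, ?_, ?_, fun θ hθ =>
      interior_density D.isOpen hexh hzc hθ⟩
    · exact hlink.mono fun δ h H hH s s' _ _ hs hs' =>
        h H hH s s' (hs.trans (min_le_left _ _)) (hs'.trans (min_le_left _ _))
    · exact hbd.mono fun δ h H hH ub wb hb sb h1 h2 s _ hs =>
        h H hH ub wb hb sb h1 h2 s (hs.trans (min_le_right _ _))
  · ---------------------------------------------------------------- a point of the gate piece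
    have hzR : ‖z - p‖ < ρ := by rwa [Metric.mem_ball, dist_eq_norm] at hzb
    have hpin := hev.mono fun δ h => h.2.2.2.2
    have hbdy := hev.mono fun δ h => h.2.1
    have hΛΩ := hev.mono fun δ h => h.2.2.2.1
    obtain ⟨η₁, C, hη₁, hC, hlink⟩ :=
      flat_link (e := e) (b := b) hρ hcar hpin hbdy hΛΩ hblim hSupGate hzR hzim hzx'
    obtain ⟨B, η₂, hB, hη₂, hbd⟩ :=
      flat_station hρ hcar hpin hbdy hΛΩ hblim hSupGate hFb hst hzR hzim hzx'
    refine ⟨min η₁ η₂, B, C, lt_min hη₁ hη₂, hB, hC, ?_, ?_, fun θ hθ =>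
      flat_density hρ hcar hpin hbdy hΛΩ hblim hzR hzim hθ⟩
    · exact hlink.mono fun δ h H hH s s' hsl hs'l hs hs' =>
        h H hH s s' hsl hs'l (hs.trans (min_le_left _ _)) (hs'.trans (min_le_left _ _))
    · exact hbd.mono fun δ h H hH ub wb hb sb h1 h2 s hsl hs =>
        h H hH ub wb hb sb h1 h2 s hsl (hs.trans (min_le_right _ _))
  · ---------------------------------------------------------------- a point of the root piece
    have hzR : ‖z - x‖ < r := by rwa [Metric.mem_ball, dist_eq_norm] at hzb
    have hpin := hevx.mono fun δ h => h.2.2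
    have hbdy := hevx.mono fun δ h => h.1
    have hΛΩ := hev.mono fun δ h => h.2.2.2.1
    obtain ⟨η₁, C, hη₁, hC, hlink⟩ :=
      flat_link (e := e) (b := b) hr hcarx hpin hbdy hΛΩ helim hSupRoot hzR hzim hzx'
    obtain ⟨B, η₂, hB, hη₂, hbd⟩ :=
      flat_station hr hcarx hpin hbdy hΛΩ helim hSupRoot hFb hst hzR hzim hzx'
    refine ⟨min η₁ η₂, B, C, lt_min hη₁ hη₂, hB, hC, ?_, ?_, fun θ hθ =>
      flat_density hr hcarx hpin hbdy hΛΩ helim hzR hzim hθ⟩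
    · exact hlink.mono fun δ h H hH s s' hsl hs'l hs hs' =>
        h H hH s s' hsl hs'l (hs.trans (min_le_left _ _)) (hs'.trans (min_le_left _ _))
    · exact hbd.mono fun δ h H hH ub wb hb sb h1 h2 s hsl hs =>
        h H hH ub wb hb sb h1 h2 s hsl (hs.trans (min_le_right _ _))

/-- **Compactness of the normalised developing maps** along a mesh sequence `ns → 0+` (the
frame's data fixed). See the module docstring. [cite: DuminilCopinSmirnov2012, §4 (precompactness of the maps H_δ)] -/
theorem developingMapsCompact_core {ns : ℕ → ℝ} (hns : Tendsto ns atTop (𝓝[>] 0)) :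
    ∃ ms : ℕ → ℕ, StrictMono ms ∧ ∃ h : ℂ → ℂ,
      ContinuousOn h ((D.carrier ∪ (({z : ℂ | z.im = (D.pt 1).im} ∩ Metric.ball (D.pt 1) ρ) ∪
        ({z : ℂ | z.im = x.im} ∩ Metric.ball x r))) \ {x}) ∧
      ∀ K : Set ℂ, IsCompact K →
        K ⊆ (D.carrier ∪ (({z : ℂ | z.im = (D.pt 1).im} ∩ Metric.ball (D.pt 1) ρ) ∪
          ({z : ℂ | z.im = x.im} ∩ Metric.ball x r))) \ {x} →
        ∀ ε : ℝ, 0 < ε → ∀ᶠ n : ℕ in atTop, ∀ H : Site 2 → ℂ,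
          IsPotential (Λ ((ns ∘ ms) n)) (e ((ns ∘ ms) n)) H →
          ∀ (ub wb : HexVertex), b ((ns ∘ ms) n) = s(ub, wb) →
          ∀ sb : Site 2, sb ∈ hexFaceVertices ub → sb ∈ hexFaceVertices wb →
          ∀ s : Site 2, IsLatticeSite (Λ ((ns ∘ ms) n)) s →
            (((ns ∘ ms) n : ℝ) : ℂ) * triEmbed s ∈ K →
            ‖(((ns ∘ ms) n : ℝ) : ℂ) * (H s - H sb) /
                  hexParafermionicObservable (Λ ((ns ∘ ms) n)) (e ((ns ∘ ms) n)) hexCriticalFugacity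
                    (5 / 8) (b ((ns ∘ ms) n)) -
                h ((((ns ∘ ms) n : ℝ) : ℂ) * triEmbed s)‖ < ε := by
  classical
  set U : Set ℂ := (D.carrier ∪ (({z : ℂ | z.im = (D.pt 1).im} ∩ Metric.ball (D.pt 1) ρ) ∪
    ({z : ℂ | z.im = x.im} ∩ Metric.ball x r))) \ {x} with hU
  have hev := hAF.2.2.1
  have hevx := hPR.2.2.1
  have hFb : ∀ᶠ δ : ℝ in 𝓝[>] 0,
      hexParafermionicObservable (Λ δ) (e δ) hexCriticalFugacity (5 / 8) (b δ) ≠ 0 :=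
    (LocalL1.eventually_normaliser_ne_zero_of_bundles hev hevx).mono fun δ h => h.1
  ---------------------------------------------------------------- reference potential and site
  have key : ∀ δ : ℝ, ∃ H : Site 2 → ℂ, ∃ t : HexVertex × HexVertex × Site 2,
      ((∃ H' : Site 2 → ℂ, IsPotential (Λ δ) (e δ) H') → IsPotential (Λ δ) (e δ) H) ∧
      (b δ ∈ hexDomainBoundary (Λ δ) → b δ = s(t.1, t.2.1) ∧ t.2.2 ∈ hexFaceVertices t.1 ∧
        t.2.2 ∈ hexFaceVertices t.2.1) := by
    intro δ
    have h1 : ∃ H : Site 2 → ℂ, (∃ H' : Site 2 → ℂ, IsPotential (Λ δ) (e δ) H') →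
        IsPotential (Λ δ) (e δ) H := by
      by_cases h : ∃ H' : Site 2 → ℂ, IsPotential (Λ δ) (e δ) H'
      · obtain ⟨H', hH'⟩ := h; exact ⟨H', fun _ => hH'⟩
      · exact ⟨fun _ => 0, fun h' => absurd h' h⟩
    have h2 : ∃ t : HexVertex × HexVertex × Site 2, b δ ∈ hexDomainBoundary (Λ δ) →
        b δ = s(t.1, t.2.1) ∧ t.2.2 ∈ hexFaceVertices t.1 ∧ t.2.2 ∈ hexFaceVertices t.2.1 := by
      by_cases h : b δ ∈ hexDomainBoundary (Λ δ)
      · obtain ⟨hedge, u, v, huv, -, -⟩ := h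
        have hadj : hexGraph.Adj u v := by
          rw [huv] at hedge; exact (SimpleGraph.mem_edgeSet hexGraph).1 hedge
        obtain ⟨sb, hsu, hsv⟩ := exists_mem_inter_of_card_eq_two ((hexGraph_adj_iff u v).1 hadj).2
        exact ⟨(u, v, sb), fun _ => ⟨huv, hsu, hsv⟩⟩
      · exact ⟨((0, 0), (0, 0), 0), fun h' => absurd h' h⟩
    obtain ⟨H, hH⟩ := h1
    obtain ⟨t, ht⟩ := h2
    exact ⟨H, t, hH, ht⟩
  choose Href tref hHref htref using key
  have hvalid : ∀ᶠ δ : ℝ in 𝓝[>] 0, IsPotential (Λ δ) (e δ) (Href δ) ∧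
      b δ = s((tref δ).1, (tref δ).2.1) ∧ (tref δ).2.2 ∈ hexFaceVertices (tref δ).1 ∧
        (tref δ).2.2 ∈ hexFaceVertices (tref δ).2.1 := by
    filter_upwards [hev, hevx] with δ h h'
    exact ⟨hHref δ (potentialExists_proof (Λ δ) h.1 (e δ) h'.1), htref δ h.2.1⟩
  set V : ℝ → Site 2 → ℂ := fun δ s => (δ : ℂ) * (Href δ s - Href δ (tref δ).2.2) /
    hexParafermionicObservable (Λ δ) (e δ) hexCriticalFugacity (5 / 8) (b δ) with hV
  have hδpos : ∀ᶠ δ : ℝ in 𝓝[>] 0, 0 < δ := (self_mem_nhdsWithin : Set.Ioi (0 : ℝ) ∈ 𝓝[>] 0)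
  have hEQ : ∀ z ∈ U, ∃ η : ℝ, 0 < η ∧ ∀ ε : ℝ, 0 < ε → ∃ θ : ℝ, 0 < θ ∧ ∀ᶠ n in atTop,
      ∀ s ∈ {s : Site 2 | IsLatticeSite (Λ (ns n)) s}, ∀ s' ∈ {s : Site 2 | IsLatticeSite (Λ (ns n)) s},
      dist (((ns n : ℝ) : ℂ) * triEmbed s) z < η → dist (((ns n : ℝ) : ℂ) * triEmbed s') z < η →
      dist (((ns n : ℝ) : ℂ) * triEmbed s) (((ns n : ℝ) : ℂ) * triEmbed s') < θ →
        dist (V (ns n) s) (V (ns n) s') ≤ ε := by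
    intro z hz
    obtain ⟨η, B, C, hη, -, hC, hlink, -, -⟩ := local_data hAF hPR hx hSup hz
    refine ⟨η, hη, fun ε hε => ⟨ε / (2 * (C + 1)), by positivity, ?_⟩⟩
    have hδε : ∀ᶠ δ : ℝ in 𝓝[>] 0, δ ∈ Set.Ioo 0 (ε / (2 * (C + 1))) := Ioo_mem_nhdsGT (by positivity)
    filter_upwards [hns.eventually hlink, hns.eventually hδε, hns.eventually hvalid] with n hn ⟨hδ0, hδε⟩
      ⟨hH, _⟩ s hs s' hs' hsz hs'z hss'
    rw [dist_eq_norm] at hsz hs'z hss' ⊢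
    have h1 := hn (Href (ns n)) hH s s' hs hs' hsz.le hs'z.le
    have e1 : V (ns n) s - V (ns n) s' = -(((ns n : ℝ) : ℂ) * (Href (ns n) s' - Href (ns n) s) /
        hexParafermionicObservable (Λ (ns n)) (e (ns n)) hexCriticalFugacity (5 / 8) (b (ns n))) := by
      simp only [hV]; ring
    rw [e1, norm_neg]
    have hC1 : 0 < C + 1 := by linarith
    have hsum : ‖((ns n : ℝ) : ℂ) * triEmbed s' - ((ns n : ℝ) : ℂ) * triEmbed s‖ + ns n <
        ε / (2 * (C + 1)) + ε / (2 * (C + 1)) := by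
      rw [norm_sub_rev]; exact add_lt_add hss' hδε
    calc ‖((ns n : ℝ) : ℂ) * (Href (ns n) s' - Href (ns n) s) /
          hexParafermionicObservable (Λ (ns n)) (e (ns n)) hexCriticalFugacity (5 / 8) (b (ns n))‖
        ≤ C * (‖((ns n : ℝ) : ℂ) * triEmbed s' - ((ns n : ℝ) : ℂ) * triEmbed s‖ + ns n) := h1
      _ ≤ (C + 1) * (‖((ns n : ℝ) : ℂ) * triEmbed s' - ((ns n : ℝ) : ℂ) * triEmbed s‖ + ns n) :=
          mul_le_mul_of_nonneg_right (by linarith) (by positivity)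
      _ ≤ (C + 1) * (ε / (2 * (C + 1)) + ε / (2 * (C + 1))) :=
          mul_le_mul_of_nonneg_left hsum.le hC1.le
      _ = ε := by field_simp; ring
  have hBD : ∀ z ∈ U, ∃ η : ℝ, 0 < η ∧ ∃ B : ℝ, ∀ᶠ n in atTop,
      ∀ s ∈ {s : Site 2 | IsLatticeSite (Λ (ns n)) s},
      dist (((ns n : ℝ) : ℂ) * triEmbed s) z < η → ‖V (ns n) s‖ ≤ B := by
    intro z hz
    obtain ⟨η, B, C, hη, -, -, -, hbd, -⟩ := local_data hAF hPR hx hSup hz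
    refine ⟨η, hη, B, ?_⟩
    filter_upwards [hns.eventually hbd, hns.eventually hvalid, hns.eventually hFb,
      hns.eventually hδpos] with n hn ⟨hH, hb, h1, h2⟩ hF hδ0 s hs hsz
    rw [dist_eq_norm] at hsz
    have h3 := hn (Href (ns n)) hH _ _ hb _ h1 h2 s hs hsz.le
    show ‖((ns n : ℝ) : ℂ) * (Href (ns n) s - Href (ns n) (tref (ns n)).2.2) /
      hexParafermionicObservable (Λ (ns n)) (e (ns n)) hexCriticalFugacity (5 / 8) (b (ns n))‖ ≤ B
    rw [norm_div, norm_mul, Complex.norm_real, Real.norm_of_nonneg hδ0.le,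
      div_le_iff₀ (norm_pos_iff.2 hF)]
    exact h3
  have hDS : ∀ z ∈ U, ∀ θ : ℝ, 0 < θ → ∀ᶠ n in atTop,
      ∃ s ∈ {s : Site 2 | IsLatticeSite (Λ (ns n)) s}, dist (((ns n : ℝ) : ℂ) * triEmbed s) z < θ := by
    intro z hz θ hθ
    obtain ⟨η, B, C, -, -, -, -, -, hds⟩ := local_data hAF hPR hx hSup hz
    filter_upwards [hns.eventually (hds θ hθ)] with n ⟨s, hs, hsz⟩
    exact ⟨s, hs, by rwa [dist_eq_norm]⟩
  ---------------------------------------------------------------- the lattice Arzelà–Ascoli theorem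
  obtain ⟨φ, hφ, h, hhc, hconv⟩ := latticeArzelaAscoli (α := Site 2) (U := U)
    (S := fun n => {s : Site 2 | IsLatticeSite (Λ (ns n)) s})
    (π := fun n s => ((ns n : ℝ) : ℂ) * triEmbed s) (f := fun n => V (ns n)) hEQ hBD hDS
  ---------------------------------------------------------------- all potentials, both sites
  refine ⟨φ, hφ, h, hhc, fun K hK hKU ε hε => ?_⟩
  have hns' : Tendsto (ns ∘ φ) atTop (𝓝[>] 0) := hns.comp hφ.tendsto_atTop
  filter_upwards [hconv K hK hKU (ε / 2) (half_pos hε),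
    hns'.eventually (normaliser_sites_close (e := e) hAF.1 hAF.2.1 (hev.mono fun δ h => h.2.2.2.2)
      (hev.mono fun δ h => h.2.1) (hev.mono fun δ h => h.2.2.2.1) hAF.2.2.2.2
      (sup_gate hAF hSup) hx.symm (half_pos hε)), hns'.eventually hvalid,
    hns'.eventually hev] with i hci hcl ⟨hHr, hbr, h1r, h2r⟩ hevi H hH ub wb hb sb hsbu hsbw s hs hsK
  simp only [Function.comp_apply] at hcl hHr hbr h1r h2r hevi hH hb hs hsK ⊢
  set δ : ℝ := ns (φ i) with hδ
  have huniq : H s - H sb = Href δ s - Href δ sb :=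
    sub_eq_sub_of_preconnected hevi.2.2.1 hH hHr (isLatticeSite_of_mem_boundary hevi.2.1 hb hsbu hsbw) hs
  have hsmall := hcl (Href δ) hHr ub wb hb sb hsbu hsbw (tref δ).1 (tref δ).2.1 hbr (tref δ).2.2 h1r h2r
  have hlim : ‖V δ s - h ((δ : ℂ) * triEmbed s)‖ < ε / 2 := by
    have := hci s hs hsK
    rwa [dist_eq_norm] at this
  have e1 : (δ : ℂ) * (H s - H sb) /
        hexParafermionicObservable (Λ δ) (e δ) hexCriticalFugacity (5 / 8) (b δ) - h ((δ : ℂ) * triEmbed s) =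
      (V δ s - h ((δ : ℂ) * triEmbed s)) + (δ : ℂ) * (Href δ (tref δ).2.2 - Href δ sb) /
        hexParafermionicObservable (Λ δ) (e δ) hexCriticalFugacity (5 / 8) (b δ) := by
    rw [huniq]; simp only [hV]; ring
  rw [e1]
  calc ‖(V δ s - h ((δ : ℂ) * triEmbed s)) + (δ : ℂ) * (Href δ (tref δ).2.2 - Href δ sb) /
        hexParafermionicObservable (Λ δ) (e δ) hexCriticalFugacity (5 / 8) (b δ)‖
      ≤ ‖V δ s - h ((δ : ℂ) * triEmbed s)‖ + ‖(δ : ℂ) * (Href δ (tref δ).2.2 - Href δ sb) /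
        hexParafermionicObservable (Λ δ) (e δ) hexCriticalFugacity (5 / 8) (b δ)‖ := norm_add_le _ _
    _ < ε / 2 + ε / 2 := add_lt_add_of_lt_of_le hlim hsmall
    _ = ε := add_halves ε

end Frame

/-- **Registered statement `developingMapsCompact`** = the skeleton's
`stub_developingMapsCompact : LocalSupBound → DevelopingMapsCompact` with the line-local
definitions (`LocalSupBound`, `AdmissibleFamily`, `PinnedFlatRoot`, `flatPoints`,
`DevelopingMapsConverge`, `DevelopingMapsCompact`) unfolded verbatim (crux
stmt-CriticalPhenomena-14004, line `pick-half-plane`). [cite: DuminilCopinSmirnov2012, §4 (precompactness of the maps H_δ)] -/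
theorem developingMapsCompact :
    (∀ (D : DobrushinDomain) (ρ : ℝ) (Λ : ℝ → Finset HexVertex) (m : ℝ → ℤ) (b : ℝ → Sym2
    HexVertex), (0 < ρ ∧ D.carrier ∩ Metric.ball (D.pt 1) ρ = {z : ℂ | (D.pt 1).im < z.im} ∩
    Metric.ball (D.pt 1) ρ ∧ (∀ᶠ δ : ℝ in 𝓝[>] 0, hexDomainSimplyConnected (Λ δ) ∧ b δ ∈
    hexDomainBoundary (Λ δ) ∧ (hexGraph.induce ((Λ δ : Finset HexVertex) : Set
    HexVertex)).Preconnected ∧ (∀ v ∈ Λ δ, (δ : ℂ) * hexCenter v ∈ D.carrier) ∧ (∀ v : HexVertex, (δ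
    : ℂ) * hexCenter v ∈ Metric.ball (D.pt 1) ρ → (v ∈ Λ δ ↔ m δ ≤ v.1 1))) ∧ (∀ K : Set ℂ,
    IsCompact K → K ⊆ D.carrier → ∀ᶠ δ : ℝ in 𝓝[>] 0, ∀ v : HexVertex, (δ : ℂ) * hexCenter v ∈ K → v
    ∈ Λ δ) ∧ Tendsto (fun δ : ℝ => (δ : ℂ) * hexMidpoint (b δ)) (𝓝[>] 0) (𝓝 (D.pt 1))) → ∀ (x : ℂ)
    (e : ℝ → Sym2 HexVertex) (r : ℝ) (mr : ℝ → ℤ), (0 < r ∧ D.carrier ∩ Metric.ball x r = {z : ℂ |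
    x.im < z.im} ∩ Metric.ball x r ∧ (∀ᶠ δ : ℝ in 𝓝[>] 0, e δ ∈ hexDomainBoundary (Λ δ) ∧ Nonempty
    (HexMidEdgeSAW (Λ δ) (e δ) (b δ)) ∧ (∀ v : HexVertex, (δ : ℂ) * hexCenter v ∈ Metric.ball x r →
    (v ∈ Λ δ ↔ mr δ ≤ v.1 1))) ∧ Tendsto (fun δ : ℝ => (δ : ℂ) * hexMidpoint (e δ)) (𝓝[>] 0) (𝓝 x))
    → x ≠ D.pt 1 → ∀ K : Set ℂ, IsCompact K → K ⊆ D.carrier ∪ (({z : ℂ | z.im = (D.pt 1).im} ∩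
    Metric.ball (D.pt 1) ρ) ∪ ({z : ℂ | z.im = x.im} ∩ Metric.ball x r)) → x ∉ K → ∃ C : ℝ, ∀ᶠ δ : ℝ
    in 𝓝[>] 0, ∀ z ∈ hexDomainMidEdges (Λ δ), (δ : ℂ) * hexMidpoint z ∈ K →
    ‖hexParafermionicObservable (Λ δ) (e δ) hexCriticalFugacity (5 / 8) z‖ ≤ C *
    ‖hexParafermionicObservable (Λ δ) (e δ) hexCriticalFugacity (5 / 8) (b δ)‖) → ∀ (D :
    DobrushinDomain) (ρ : ℝ) (Λ : ℝ → Finset HexVertex) (m : ℝ → ℤ) (b : ℝ → Sym2 HexVertex), (0 < ρ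
    ∧ D.carrier ∩ Metric.ball (D.pt 1) ρ = {z : ℂ | (D.pt 1).im < z.im} ∩ Metric.ball (D.pt 1) ρ ∧
    (∀ᶠ δ : ℝ in 𝓝[>] 0, hexDomainSimplyConnected (Λ δ) ∧ b δ ∈ hexDomainBoundary (Λ δ) ∧
    (hexGraph.induce ((Λ δ : Finset HexVertex) : Set HexVertex)).Preconnected ∧ (∀ v ∈ Λ δ, (δ : ℂ)
    * hexCenter v ∈ D.carrier) ∧ (∀ v : HexVertex, (δ : ℂ) * hexCenter v ∈ Metric.ball (D.pt 1) ρ →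
    (v ∈ Λ δ ↔ m δ ≤ v.1 1))) ∧ (∀ K : Set ℂ, IsCompact K → K ⊆ D.carrier → ∀ᶠ δ : ℝ in 𝓝[>] 0, ∀ v
    : HexVertex, (δ : ℂ) * hexCenter v ∈ K → v ∈ Λ δ) ∧ Tendsto (fun δ : ℝ => (δ : ℂ) * hexMidpoint
    (b δ)) (𝓝[>] 0) (𝓝 (D.pt 1))) → ∀ (x : ℂ) (e : ℝ → Sym2 HexVertex) (r : ℝ) (mr : ℝ → ℤ), (0 < r
    ∧ D.carrier ∩ Metric.ball x r = {z : ℂ | x.im < z.im} ∩ Metric.ball x r ∧ (∀ᶠ δ : ℝ in 𝓝[>] 0, e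
    δ ∈ hexDomainBoundary (Λ δ) ∧ Nonempty (HexMidEdgeSAW (Λ δ) (e δ) (b δ)) ∧ (∀ v : HexVertex, (δ
    : ℂ) * hexCenter v ∈ Metric.ball x r → (v ∈ Λ δ ↔ mr δ ≤ v.1 1))) ∧ Tendsto (fun δ : ℝ => (δ :
    ℂ) * hexMidpoint (e δ)) (𝓝[>] 0) (𝓝 x)) → x ≠ D.pt 1 → ∀ ns : ℕ → ℝ, Tendsto ns atTop (𝓝[>] 0) →
    ∃ ms : ℕ → ℕ, StrictMono ms ∧ ∃ h : ℂ → ℂ, ContinuousOn h ((D.carrier ∪ (({z : ℂ | z.im = (D.pt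
    1).im} ∩ Metric.ball (D.pt 1) ρ) ∪ ({z : ℂ | z.im = x.im} ∩ Metric.ball x r))) \ {x}) ∧ ∀ K :
    Set ℂ, IsCompact K → K ⊆ (D.carrier ∪ (({z : ℂ | z.im = (D.pt 1).im} ∩ Metric.ball (D.pt 1) ρ) ∪
    ({z : ℂ | z.im = x.im} ∩ Metric.ball x r))) \ {x} → ∀ ε : ℝ, 0 < ε → ∀ᶠ n : ℕ in atTop, ∀ H :
    Site 2 → ℂ, IsPotential (Λ ((ns ∘ ms) n)) (e ((ns ∘ ms) n)) H → ∀ (ub wb : HexVertex), b ((ns ∘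
    ms) n) = s(ub, wb) → ∀ sb : Site 2, sb ∈ hexFaceVertices ub → sb ∈ hexFaceVertices wb → ∀ s :
    Site 2, IsLatticeSite (Λ ((ns ∘ ms) n)) s → (((ns ∘ ms) n : ℝ) : ℂ) * triEmbed s ∈ K → ‖(((ns ∘
    ms) n : ℝ) : ℂ) * (H s - H sb) / hexParafermionicObservable (Λ ((ns ∘ ms) n)) (e ((ns ∘ ms) n))
    hexCriticalFugacity (5 / 8) (b ((ns ∘ ms) n)) - h ((((ns ∘ ms) n : ℝ) : ℂ) * triEmbed s)‖ < ε :=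
  fun hLSB D ρ Λ m b hAF x e r mr hPR hx _ hns =>
    developingMapsCompact_core hAF hPR hx (hLSB D ρ Λ m b hAF x e r mr hPR hx) hns

end Summit.CriticalPhenomena.SAWScalingLimit.Theorems.PickHalfPlane.DevelopingMaps

end
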